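import Mathlib.Analysis.Fourier.FiniteAbelian.PontryaginDuality
import Mathlib.Data.ZMod.Basic
import Literature.NumberTheory.Rogawski1990.PreStabilisationCount
import HarnessLib

/-!
# The `κ`-group of a regular elliptic class has order `2^{r′−1}`: `#{ε ∈ (ℤ∕2)^{r′} : Σ ε = 0} = 2^{r′−1}`, hence `|𝓡| = |Â| = 2^{r′−1}`, and the
# reading `2^{r′−1} = 1 + #{𝒪H ↦ 𝒪}` through the (5.4.5) datum (Rogawski (1990), §3.5 Prop. 3.5.2 (c) p. 29, §3.6, §5.4 (5.4.5) pp. 72–73)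

Topic `NumberTheory/Rogawski1990`; namespace `Literature.NumberTheory.Rogawski1990`.  THEOREMS ONLY (no definition, no named fact, no instance, no
notation, no `sorry`).  Cell `pub/hodgecm-mathlib`, ENGINE T1 (crux item stmt-HodgeConjecture-24833), F0P3a-plan (g4) GO #98 (3) row **(R𝓡) «KAPPA-GROUP
CARDINALITY»** for LEAD DECISION #2 (RULING #91): the per-regular-`γ₀` package takes `A(γ₀) :=` the SUM-ZERO HYPERPLANE of `(ℤ∕2ℤ)^{r′}` (`r′ = r′(γ₀)` the
number of simple factors of the Cartan algebra `L[γ₀]`; types (1) ∕ (2) ∕ (3) of [Rogawski1990, §3.6] have `r′ = 3 ∕ 2 ∕ 1`) and `𝓡 := ⊤ ≤ Hom(A, ℂˣ)`;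
print: «`𝔇(T∕F)` … has order `4` if `T` is of type (1), `2` for type (2), `1` for type (3)» [§3.6 p. 31; §5.4 p. 72], «`ℛ(T∕F) = 𝔇(T∕F)^D`» [§3.5 Prop. 3.5.2 (c)].

* §1 **`card_subtype_sum_eq_zero_zmod_two`** — `Fintype.card {ε : Fin (n+1) → ZMod 2 // ∑ i, ε i = 0} = 2 ^ n` by the explicit bijection with
  `Fin n → ZMod 2` (drop the last coordinate; it is determined by the others), and the `1 ≤ r` form **`card_subtype_sum_eq_zero_zmod_two_of_one_le`**:
  `Fintype.card {ε : Fin r → ZMod 2 // ∑ i, ε i = 0} = 2 ^ (r - 1)`; the same for ANY additive subgroup `K ≤ (Fin r → ZMod 2)` whose membership is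
  `∑ i, ε i = 0` (**`natCard_addSubgroup_eq_two_pow_of_mem_iff`** — so the package may realise `A` as a kernel ∕ `AddSubgroup` of its choice).
* §2 the CHARACTER GROUP (the package's `𝓡 = ⊤`): **`card_addChar_eq_two_pow_of_mem_iff`** — `Fintype.card (AddChar K ℂ) = 2 ^ (r - 1)` (Mathlib ★
  `AddChar.card_eq`, Pontryagin duality for finite abelian groups) and **`natCard_top_subgroup_addChar_eq_two_pow_of_mem_iff`** — `Nat.card (⊤ : Subgroup (AddChar K ℂ)) = 2 ^ (r - 1)`.
* §3 the (5.4.5) READING: with the package's datum `e : I → 𝓡` injective onto the non-trivial characters (`I` = the `H`-classes transferring to `𝒪(γ₀)`),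
  ★ `card_subgroup_eq_card_add_one` gives `|𝓡| = |I| + 1`; hence **`two_pow_eq_card_add_one_of_mem_iff`**: `2 ^ (r - 1) = Fintype.card I + 1` for
  `𝓡 = ⊤` — «`|ℛ(T∕F)| = 1 + #{𝒪′_st ↦ 𝒪_st}`», `4 = 1 + 3`, `2 = 1 + 1`, `1 = 1 + 0` [§5.4 (5.4.5) p. 73].
HONEST LABEL: the EXISTENCE of `e` (equivalently the count `#{𝒪H ↦ 𝒪(γ₀)} = 2^{r′−1} − 1` from the Cartan type of `γ₀` alone) is NOT proved here — it is a clause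
of the posited per-`γ₀` package (its kernel road = Kottwitz–Steinberg for the quasi-split `U(1,1)`, the rank-2 twin of ★ `KottwitzSteinbergRankThree`); the tree
has the injection ★ `StableClassH.injOn_sndVal_setOf_transfersTo` (`#{𝒪H ↦ 𝒪} ≤ #roots ≤ 3`).  HC_CM is proved only modulo the printed citations until rung 0
closes; this file is unconditional.

## References
* [Rogawski1990] J. D. Rogawski, *Automorphic Representations of Unitary Groups in Three Variables*, Ann. of Math. Stud. 123 (1990), §3.5 Prop. 3.5.2 (c)
  p. 29, §3.6 p. 31, §5.4 (5.4.5) pp. 72–73.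
-/

set_option autoImplicit false

noncomputable section

namespace Literature.NumberTheory.Rogawski1990

open Finset

/-! ## §1 `#{ε ∈ (ℤ∕2)^{n+1} : Σ ε = 0} = 2^n` -/

/-- The last coordinate of a sum-zero vector is minus the sum of the others. [cite: Rogawski1990, §3.5 Prop. 3.5.2 p. 29] -/
theorem apply_last_eq_neg_sum_of_sum_eq_zero {M : Type*} [AddCommGroup M] {n : ℕ} {ε : Fin (n + 1) → M} (h : ∑ i, ε i = 0) :
    ε (Fin.last n) = -∑ i : Fin n, ε (Fin.castSucc i) := by
  rw [Fin.sum_univ_castSucc] at h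
  exact eq_neg_of_add_eq_zero_right h

/-- Extending `δ ∈ M^n` by the coordinate `−Σ δ` gives a sum-zero vector of `M^{n+1}`. [cite: Rogawski1990, §3.5 Prop. 3.5.2 p. 29] -/
theorem sum_snoc_neg_sum_eq_zero {M : Type*} [AddCommGroup M] {n : ℕ} (δ : Fin n → M) :
    ∑ i, (Fin.snoc δ (-∑ j, δ j) : Fin (n + 1) → M) i = 0 := by
  rw [Fin.sum_univ_castSucc]
  simp only [Fin.snoc_castSucc, Fin.snoc_last, add_neg_cancel]

/-- **`#{ε ∈ M^{n+1} : Σ ε = 0} = #M^n`** for a finite additive group `M`: the sum-zero vectors of length `n + 1` are in bijection with all vectors of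
length `n` (drop the last coordinate). [cite: Rogawski1990, §3.5 Prop. 3.5.2 p. 29] -/
theorem card_subtype_sum_eq_zero_eq_card_fun {M : Type*} [AddCommGroup M] [Fintype M] [DecidableEq M] (n : ℕ) :
    Fintype.card {ε : Fin (n + 1) → M // ∑ i, ε i = 0} = Fintype.card (Fin n → M) := by
  refine Fintype.card_congr
    { toFun := fun ε i => ε.1 (Fin.castSucc i)
      invFun := fun δ => ⟨Fin.snoc δ (-∑ j, δ j), sum_snoc_neg_sum_eq_zero δ⟩
      left_inv := fun ε => ?_
      right_inv := fun δ => ?_ }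
  · apply Subtype.ext
    funext i
    refine Fin.lastCases ?_ (fun j => ?_) i
    · simp only [Fin.snoc_last]
      exact (apply_last_eq_neg_sum_of_sum_eq_zero ε.2).symm
    · simp only [Fin.snoc_castSucc]
  · funext i
    simp only [Fin.snoc_castSucc]

/-- **`#{ε ∈ (ℤ∕2)^{n+1} : Σ ε = 0} = 2^n`.** [cite: Rogawski1990, §3.5 Prop. 3.5.2 (c) p. 29; §3.6 p. 31] -/
theorem card_subtype_sum_eq_zero_zmod_two (n : ℕ) : Fintype.card {ε : Fin (n + 1) → ZMod 2 // ∑ i, ε i = 0} = 2 ^ n := by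
  rw [card_subtype_sum_eq_zero_eq_card_fun, Fintype.card_fun, ZMod.card, Fintype.card_fin]

/-- **`#{ε ∈ (ℤ∕2)^r : Σ ε = 0} = 2^{r−1}` for `1 ≤ r`** — the order of the sum-zero hyperplane `A(γ₀)`, `r = r′(γ₀)`: `4 ∕ 2 ∕ 1` for `r = 3 ∕ 2 ∕ 1`
(Cartan types (1) ∕ (2) ∕ (3)). [cite: Rogawski1990, §3.6 p. 31; §5.4 p. 72] -/
theorem card_subtype_sum_eq_zero_zmod_two_of_one_le {r : ℕ} (hr : 1 ≤ r) : Fintype.card {ε : Fin r → ZMod 2 // ∑ i, ε i = 0} = 2 ^ (r - 1) := by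
  obtain ⟨n, rfl⟩ := Nat.exists_eq_add_of_le' hr
  rw [Nat.add_sub_cancel]
  exact card_subtype_sum_eq_zero_zmod_two n

/-- Junk-value record: for `r = 0` the hyperplane is all of `(ℤ∕2)^0`, a point (`card = 1 = 2^0`, consistent with `2 ^ (0 - 1) = 2 ^ 0`). [folklore] -/
private theorem card_subtype_sum_eq_zero_zmod_two_zero : Fintype.card {ε : Fin 0 → ZMod 2 // ∑ i, ε i = 0} = 1 := by
  rw [Fintype.card_eq_one_iff]
  exact ⟨⟨fun i => i.elim0, by simp⟩, fun ε => Subtype.ext (funext fun i => i.elim0)⟩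

/-- `#{ε ∈ (ℤ∕2)^r : Σ ε = 0} = 2^{r−1}` for EVERY `r` (at `r = 0` both sides are `1`). [cite: Rogawski1990, §3.6 p. 31] -/
theorem card_subtype_sum_eq_zero_zmod_two' (r : ℕ) : Fintype.card {ε : Fin r → ZMod 2 // ∑ i, ε i = 0} = 2 ^ (r - 1) := by
  rcases Nat.eq_zero_or_pos r with rfl | hr
  · rw [card_subtype_sum_eq_zero_zmod_two_zero, Nat.zero_sub, pow_zero]
  · exact card_subtype_sum_eq_zero_zmod_two_of_one_le hr

/-- **The same for any additive subgroup `K ≤ (ℤ∕2)^r` whose membership is `Σ ε = 0`** (so the package may realise `A(γ₀)` as the kernel of the sum map,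
as a `Submodule`, …): `Nat.card K = 2^{r−1}`. [cite: Rogawski1990, §3.6 p. 31; §5.4 p. 72] -/
theorem natCard_addSubgroup_eq_two_pow_of_mem_iff {r : ℕ} (K : AddSubgroup (Fin r → ZMod 2)) (hK : ∀ ε, ε ∈ K ↔ ∑ i, ε i = 0) :
    Nat.card K = 2 ^ (r - 1) := by
  classical
  rw [Nat.card_eq_fintype_card, ← card_subtype_sum_eq_zero_zmod_two' r]
  exact Fintype.card_congr (Equiv.subtypeEquivRight hK)

/-! ## §2 The character group `𝓡 = Hom(A, ℂˣ)` has the same order -/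

/-- **`|Â| = 2^{r−1}`**: the number of characters `A → ℂˣ` of the sum-zero hyperplane `A ≤ (ℤ∕2)^r` (★ Mathlib `AddChar.card_eq`, finite abelian duality) —
the order of `ℛ(T∕F) = 𝔇(T∕F)^D`. [cite: Rogawski1990, §3.5 Prop. 3.5.2 (c) p. 29; §3.6 p. 31] -/
theorem card_addChar_eq_two_pow_of_mem_iff {r : ℕ} (K : AddSubgroup (Fin r → ZMod 2)) (hK : ∀ ε, ε ∈ K ↔ ∑ i, ε i = 0) :
    Fintype.card (AddChar K ℂ) = 2 ^ (r - 1) := by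
  classical
  rw [AddChar.card_eq, ← Nat.card_eq_fintype_card]
  exact natCard_addSubgroup_eq_two_pow_of_mem_iff K hK

/-- **`|𝓡| = 2^{r−1}` for `𝓡 = ⊤`** (all characters of `A`, LEAD DECISION #2's choice), as a `Nat.card` of the top subgroup. [cite: Rogawski1990, §3.6 p. 31] -/
theorem natCard_top_subgroup_addChar_eq_two_pow_of_mem_iff {r : ℕ} (K : AddSubgroup (Fin r → ZMod 2)) (hK : ∀ ε, ε ∈ K ↔ ∑ i, ε i = 0) :
    Nat.card (⊤ : Subgroup (AddChar K ℂ)) = 2 ^ (r - 1) := by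
  classical
  rw [Subgroup.card_top, Nat.card_eq_fintype_card]
  exact card_addChar_eq_two_pow_of_mem_iff K hK

/-- The `Fintype.card` form of the previous statement (any `Fintype` instance on `↥⊤`). [cite: Rogawski1990, §3.6 p. 31] -/
theorem card_top_subgroup_addChar_eq_two_pow_of_mem_iff {r : ℕ} (K : AddSubgroup (Fin r → ZMod 2)) (hK : ∀ ε, ε ∈ K ↔ ∑ i, ε i = 0)
    [Fintype (⊤ : Subgroup (AddChar K ℂ))] : Fintype.card (⊤ : Subgroup (AddChar K ℂ)) = 2 ^ (r - 1) := by
  rw [← Nat.card_eq_fintype_card]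
  exact natCard_top_subgroup_addChar_eq_two_pow_of_mem_iff K hK

/-! ## §3 The (5.4.5) reading `2^{r−1} = 1 + #{𝒪H ↦ 𝒪}` through the package's datum `e` -/

/-- **`|𝓡| = |I| + 1` ⟹ `2^{r−1} = |I| + 1`**: for `𝓡 = ⊤ ≤ Hom(A, ℂˣ)` over the sum-zero hyperplane `A ≤ (ℤ∕2)^r` and a datum `e : I → 𝓡` injective onto the
non-trivial characters (the (5.4.5) bijection `{𝒪′_st ↦ 𝒪_st} ↔ {κ ≠ 1}` of the per-`γ₀` package; ★ `card_subgroup_eq_card_add_one`), the number `|I|` of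
`H`-classes transferring to `𝒪(γ₀)` is `2^{r−1} − 1`: `3 ∕ 1 ∕ 0` for the Cartan types (1) ∕ (2) ∕ (3). [cite: Rogawski1990, §5.4 (5.4.5) pp. 72–73; §3.6 p. 31] -/
theorem two_pow_eq_card_add_one_of_mem_iff {r : ℕ} (K : AddSubgroup (Fin r → ZMod 2)) (hK : ∀ ε, ε ∈ K ↔ ∑ i, ε i = 0)
    [Fintype (⊤ : Subgroup (AddChar K ℂ))] {I : Type*} [Fintype I] (e : I → (⊤ : Subgroup (AddChar K ℂ)))
    (he1 : ∀ i, e i ≠ 1) (hinj : Function.Injective e) (hsurj : ∀ κ : (⊤ : Subgroup (AddChar K ℂ)), κ ≠ 1 → ∃ i, e i = κ) :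
    2 ^ (r - 1) = Fintype.card I + 1 := by
  rw [← card_top_subgroup_addChar_eq_two_pow_of_mem_iff K hK]
  exact card_subgroup_eq_card_add_one ⊤ e he1 hinj hsurj

/-- The same with `I` a subtype counted by `Nat.card` (e.g. `I = {𝒪H // 𝒪H ↦ 𝒪(γ₀)}`, finite by ★ `StableClassH.finite_subtype_transfersTo_antidiagOne`):
`Nat.card I + 1 = 2^{r−1}`. [cite: Rogawski1990, §5.4 (5.4.5) pp. 72–73] -/
theorem natCard_add_one_eq_two_pow_of_mem_iff {r : ℕ} (K : AddSubgroup (Fin r → ZMod 2)) (hK : ∀ ε, ε ∈ K ↔ ∑ i, ε i = 0)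
    [Fintype (⊤ : Subgroup (AddChar K ℂ))] {I : Type*} [Finite I] (e : I → (⊤ : Subgroup (AddChar K ℂ)))
    (he1 : ∀ i, e i ≠ 1) (hinj : Function.Injective e) (hsurj : ∀ κ : (⊤ : Subgroup (AddChar K ℂ)), κ ≠ 1 → ∃ i, e i = κ) :
    Nat.card I + 1 = 2 ^ (r - 1) := by
  haveI := Fintype.ofFinite I
  rw [Nat.card_eq_fintype_card]
  exact (two_pow_eq_card_add_one_of_mem_iff K hK e he1 hinj hsurj).symm

end Literature.NumberTheory.Rogawski1990

end
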